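import Literature.AlgebraicGeometry.Resolution.LogBlowupOrthant
import HarnessLib

/-!
# Orthant-like blow-up charts from a GIVEN regular projective subdivision — Kato (10.4), atlas form

`Literature/AlgebraicGeometry/Resolution/LogBlowupOrthantRelative.lean`. The one-chart theorem
`LogBlowup.exists_finset_isOrthantLike_blowupChartMonoid` (`LogBlowupOrthant.lean`) chooses a
regular projective subdivision of `σ = P^∨` internally. For several charts (K. Kato, *Toric
singularities*, Amer. J. Math. 116 (1994), (10.4): ONE subdivision of the fan `F(X)`, restricted
to the cone of each chart) the subdivision and its support function are GIVEN, compatibly on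
overlaps, and the Veronese degree must be common to all charts. This file re-runs the
construction with these as parameters:

* `veronese_mul` — a multiple of a Veronese degree of the section monoid is a Veronese degree;
* `exists_finset_isOrthantLike_of_isStrictSupport` — for `P ⊆ ℤⁿ` finitely generated,
  saturated, spanning, a regular fan `Δ` with support `P^∨` and tight integral strict support
  data `m ≥ 0` on it, and a Veronese degree `k > 0`: a finite non-empty `s ⊆ P` with
  `s ⊆ Γ_k`, `Γ_k = s + Γ₀` (`Γ₀ = P`), and every chart monoid `P⟨s − a⟩`, `a ∈ s`, orthant-like
  `ℕ^I ⊕ ℤ^{Iᶜ}` in a `ℤ`-basis of `ℤⁿ`.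

References: [Kato1994] (9.8), (10.4); [KempfEtAl1973] Ch. I §2 Thm. 11, Ch. II §2.
-/

noncomputable section

namespace Literature.AlgebraicGeometry.Resolution

namespace LogBlowup

open PointedCone Literature.Geometry.PolyhedralFans Literature.Combinatorics.Optimization.HilbertBasis
  LogRefinedChart

universe u

variable {n : ℕ}

/-- **Multiples of a Veronese degree are Veronese degrees**: if every element of `Γ_{jk}` is a
sum of `j` elements of `Γ_k` (all `j > 0`), then the same holds with `k` replaced by `c k`,
`c > 0`. [cite: Kato1994, (10.4)] -/
theorem veronese_mul (Δ : Fan ℚ (Fin n → ℚ)) (m : PointedCone ℚ (Fin n → ℚ) → (Fin n → ℚ))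
    {k : ℕ} (hver : ∀ j : ℕ, 0 < j → ∀ u ∈ piece Δ m (j * k),
      ∃ us : Fin j → Fin n → ℤ, (∀ i, us i ∈ piece Δ m k) ∧ u = ∑ i, us i)
    {c : ℕ} (hc : 0 < c) :
    ∀ j : ℕ, 0 < j → ∀ u ∈ piece Δ m (j * (c * k)),
      ∃ us : Fin j → Fin n → ℤ, (∀ i, us i ∈ piece Δ m (c * k)) ∧ u = ∑ i, us i := by
  intro j hj u hu
  rw [← mul_assoc] at hu
  obtain ⟨us, hus, rfl⟩ := hver (j * c) (Nat.mul_pos hj hc) u hu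
  -- group the `j c` summands into `j` blocks of `c`
  refine ⟨fun i => ∑ a : Fin c, us (finProdFinEquiv (i, a)), fun i => ?_, ?_⟩
  · -- a sum of `c` elements of `Γ_k` lies in `Γ_{ck}`
    have : ∀ (t : Finset (Fin c)), ∑ a ∈ t, us (finProdFinEquiv (i, a)) ∈ piece Δ m (t.card * k) := by
      intro t
      classical
      induction t using Finset.induction_on with
      | empty =>
        rw [Finset.sum_empty, Finset.card_empty, zero_mul]
        exact (pieceZero Δ m).zero_mem
      | insert a t hat ih =>
        rw [Finset.sum_insert hat, Finset.card_insert_of_notMem hat, Nat.succ_mul, add_comm (t.card * k)]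
        exact add_mem_piece Δ m (hus _) ih
    have h := this Finset.univ
    rwa [Finset.card_univ, Fintype.card_fin] at h
  · rw [← Finset.sum_product', Finset.univ_product_univ, ← finProdFinEquiv.sum_comp]

/-- **Orthant-like blow-up charts from a given subdivision.** Let `P ⊆ ℤⁿ` be finitely
generated, saturated and spanning, `Δ` a regular fan with support `σ = P^∨` carrying tight
integral strict support data `m`, non-negative on `σ`, and `k > 0` a Veronese degree of the
section monoid. Then the degree-`k` piece `Γ_k` is generated over `Γ₀ = P` by a finite non-empty
`s ⊆ P`, and for every `a ∈ s` the chart monoid `P⟨s − a⟩` is the dual monoid of a (regular)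
cone of `Δ`, hence `ℕ^I ⊕ ℤ^{Iᶜ}` in a `ℤ`-basis of `ℤⁿ` (`IsOrthantLike`). [cite: Kato1994, (10.4)] [cite: KempfEtAl1973, Ch. I §2 Thm. 11] -/
theorem exists_finset_isOrthantLike_of_isStrictSupport (P : AddSubmonoid (Fin n → ℤ)) (hP : P.FG)
    (hsat : ∀ (v : Fin n → ℤ) (k : ℕ), 0 < k → k • v ∈ P → v ∈ P)
    (Δ : Fan ℚ (Fin n → ℚ)) (hsupp : Δ.support = (dualCone P : Set (Fin n → ℚ)))
    (hreg : Δ.IsRegular) (m : PointedCone ℚ (Fin n → ℚ) → (Fin n → ℚ))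
    (hm : Δ.IsStrictSupport m) (hint : ∀ ρ ∈ Δ.cones, m ρ ∈ latticeN (Fin n))
    (hnn : ∀ ρ ∈ Δ.cones, ∀ x ∈ dualCone P, 0 ≤ m ρ ⬝ᵥ x) {k : ℕ} (hk : 0 < k)
    (hver : ∀ j : ℕ, 0 < j → ∀ u ∈ piece Δ m (j * k),
      ∃ us : Fin j → Fin n → ℤ, (∀ i, us i ∈ piece Δ m k) ∧ u = ∑ i, us i) :
    ∃ s : Finset P, s.Nonempty ∧ (∀ a ∈ s, (a : Fin n → ℤ) ∈ piece Δ m k) ∧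
      (∀ u ∈ piece Δ m k, ∃ a ∈ s, u - (a : Fin n → ℤ) ∈ P) ∧
      ∀ a ∈ s, ∃ (b : Module.Basis (Fin n) ℤ (Fin n → ℤ)) (I : Finset (Fin n)),
        IsOrthantLike b I (LogChart.blowupChartMonoid P (↑s : Set P) a) := by
  classical
  set σ := dualCone P with hσ
  have hadd : ∀ x ∈ Δ.support, ∀ y ∈ Δ.support, x + y ∈ Δ.support := by
    intro x hx y hy; rw [hsupp] at *; exact σ.add_mem hx hy
  have hne : Δ.cones.Nonempty := by
    have : (0 : Fin n → ℚ) ∈ Δ.support := by rw [hsupp]; exact σ.zero_mem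
    obtain ⟨ρ, hρ, -⟩ := Fan.mem_support.1 this
    exact ⟨ρ, hρ⟩
  -- generators of the cones
  let gens : PointedCone ℚ (Fin n → ℚ) → Finset (Fin n → ℚ) := fun ρ =>
    if h : ρ ∈ Δ.cones then (Δ.fg h).choose else ∅
  have hgens : ∀ ρ ∈ Δ.cones, PointedCone.hull ℚ (gens ρ : Set (Fin n → ℚ)) = ρ := by
    intro ρ hρ; simp only [gens, dif_pos hρ]; exact (Δ.fg hρ).choose_spec
  -- `Γ₀ = P`
  have hP0 : (pieceZero Δ m : Set (Fin n → ℤ)) = P := by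
    ext u
    rw [SetLike.mem_coe, mem_pieceZero_iff, SetLike.mem_coe]
    constructor
    · intro hu
      refine mem_of_forall_dualCone P hP hsat fun v hv => ?_
      have hv' : v ∈ Δ.support := by rw [hsupp]; exact hv
      obtain ⟨ρ, hρ, hvρ⟩ := Fan.mem_support.1 hv'
      exact hu ρ hρ v hvρ
    · intro hu ρ hρ v hvρ
      have hv : v ∈ σ := by
        have : v ∈ Δ.support := Fan.mem_support.2 ⟨ρ, hρ, hvρ⟩
        rwa [hsupp] at this
      exact hv u hu
  -- pieces lie in `P` (as `m ≥ 0` on `σ`)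
  have hpieceP : ∀ j, piece Δ m j ⊆ P := by
    intro j u hu
    have goal : u ∈ (P : Set (Fin n → ℤ)) := by
      rw [← hP0, SetLike.mem_coe, mem_pieceZero_iff]
      intro ρ hρ v hvρ
      have h1 := (mem_secMonoid_iff Δ m).1 hu ρ hρ v hvρ
      rw [sub_dotProduct, smul_dotProduct, smul_eq_mul, sub_nonneg] at h1
      have hv : v ∈ σ := by
        have : v ∈ Δ.support := Fan.mem_support.2 ⟨ρ, hρ, hvρ⟩
        rwa [hsupp] at this
      exact le_trans (mul_nonneg (Nat.cast_nonneg j) (hnn ρ hρ v hv)) h1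
    exact goal
  -- generators of `Γ_k`
  obtain ⟨s₀, hs₀k, hs₀gen⟩ := exists_piece_generators Δ m k
  -- `Γ_k ≠ ∅`: `k • m ρ ∈ Γ_k`
  obtain ⟨ρ₁, hρ₁⟩ := hne
  obtain ⟨u₁, hu₁⟩ : ∃ u₁ : Fin n → ℤ, toRat u₁ = m ρ₁ := by
    choose f hf using hint ρ₁ hρ₁
    exact ⟨fun i => f i, funext fun i => (hf i).symm⟩
  have hku₁ : k • u₁ ∈ piece Δ m k := by
    rw [mem_piece_iff, mem_secMonoid_iff]
    intro ρ hρ v hv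
    simp only
    rw [toRat_nsmul, hu₁, ← smul_sub, smul_dotProduct, smul_eq_mul, sub_dotProduct]
    exact mul_nonneg (Nat.cast_nonneg k) (sub_nonneg.2 (hm hρ₁ hρ hv).1)
  have hs₀ne : s₀.Nonempty := by
    obtain ⟨y, hy, -⟩ := hs₀gen _ hku₁
    exact ⟨y, hy⟩
  -- the finite set `s ⊆ P`
  let s : Finset P := s₀.attach.image fun y : ↥s₀ => (⟨(y : Fin n → ℤ), hpieceP k (hs₀k y.2)⟩ : P)
  have hs_coe : ∀ a : P, a ∈ s ↔ (a : Fin n → ℤ) ∈ s₀ := by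
    intro a
    constructor
    · intro h
      obtain ⟨y, -, hy⟩ := Finset.mem_image.1 h
      rw [← hy]; exact y.2
    · intro h
      exact Finset.mem_image.2 ⟨⟨(a : Fin n → ℤ), h⟩, Finset.mem_attach _ _, Subtype.ext rfl⟩
  refine ⟨s, ?_, fun a ha => hs₀k ((hs_coe a).1 ha), fun u hu => ?_, fun a ha => ?_⟩
  · obtain ⟨y, hy⟩ := hs₀ne
    exact ⟨⟨y, hpieceP k (hs₀k hy)⟩, (hs_coe _).2 hy⟩
  · obtain ⟨y, hy, z, hz, rfl⟩ := hs₀gen u hu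
    refine ⟨⟨y, hpieceP k (hs₀k hy)⟩, (hs_coe _).2 hy, ?_⟩
    have hz' : z ∈ (P : Set (Fin n → ℤ)) := by rw [← hP0]; exact hz
    simpa using hz'
  -- the chart at `a`
  have ha₀ : (a : Fin n → ℤ) ∈ s₀ := (hs_coe a).1 ha
  obtain ⟨τ, hτ, htight⟩ := exists_tight_cone Δ m gens hgens hm hadd ⟨ρ₁, hρ₁⟩ hk (hs₀k ha₀)
  have hclos := closure_eq_setOf_exists Δ m hver hs₀k hs₀gen ha₀
  -- the chart monoid is `τ^∨ ∩ ℤⁿ`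
  have hchart : ∀ x : Fin n → ℤ, x ∈ LogChart.blowupChartMonoid P (↑s : Set P) a ↔
      ∀ v ∈ τ, 0 ≤ toRat x ⬝ᵥ v := by
    intro x
    have hgenset : ((P : Set (Fin n → ℤ)) ∪ (fun g : P => (g : Fin n → ℤ) - a) '' (↑s : Set P)) =
        (pieceZero Δ m : Set (Fin n → ℤ)) ∪ (fun y => y - (a : Fin n → ℤ)) '' (↑s₀ : Set (Fin n → ℤ)) := by
      rw [hP0]
      congr 1
      ext z
      simp only [Set.mem_image, Finset.mem_coe]
      constructor
      · rintro ⟨g, hg, rfl⟩; exact ⟨g, (hs_coe g).1 hg, rfl⟩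
      · rintro ⟨y, hy, rfl⟩; exact ⟨⟨y, hpieceP k (hs₀k hy)⟩, (hs_coe _).2 hy, rfl⟩
    rw [LogChart.blowupChartMonoid, hgenset, ← SetLike.mem_coe, hclos, Set.mem_setOf_eq, htight]
  -- `τ` is regular: dual basis
  obtain ⟨S, hS, hτS⟩ := hreg hτ
  obtain ⟨b, I, -, hbI⟩ := hS.exists_dual_basis
  refine ⟨b, I, ⟨fun x => ?_⟩⟩
  rw [hchart, ← hbI, hτS, forall_mem_hull_dotProduct_nonneg_iff]

end LogBlowup

end Literature.AlgebraicGeometry.Resolution
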